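import Summits.ResolutionOfSingularities.ResolutionOfSingularities.Theorems.WildConesCampaignW46TjurinaInvarianceRing
import Summits.ResolutionOfSingularities.ResolutionOfSingularities.Theorems.WildConesCampaignW46AtomGermTjurinaIdeal
import HarnessLib

/-!
# [OURS · L1 W4.6, rungs (i)/(ii) — the dictionary, SCHEME HALF, brick 15] Isolatedness does not depend on the
# presentation: `Isol` transfers between any two formal presentations of the same principal ideal
Cell res-hironaka (LADDER-RESOLUTION rung L, D-0089), slot W4.6, seat res-L1-s46-pv-2 (gen 3). Host: route
`WildCones`, crux `ClassicalRegimes` (stmt-ResolutionOfSingularities-16884), `--supports … --as helper`.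

HONEST FRAMING. Everything here is OURS — ring-level bookkeeping over this seat's bricks 3′ (`isol_iff_finite_tjurina'`,
`Isol` = finite Tjurina algebra of the atom) and 14 (`finite_tjurina_iff_of_ringEquiv_option`, the Tjurina algebra is
intrinsic under RING automorphisms over a perfect field). NOTHING here is a statement of H. Hironaka's manuscript
[Hironaka2017]; no FACT-LIST premise. AI review is weaker than expert review.

## What is proved

`CampaignW46.AtomGerm.isol_iff_isol_of_span_eq`. Let `R` be a local ring, `S` an `R`-algebra (in the rung: `R = 𝒪_{Z,ξ}`,
`S` its `𝔪`-adic completion), `K` a perfect field of characteristic `p`, and let `(E₀, f₀, c₀, w)`, `(E₀′, f₀′, c₀′, w′)`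
be two PRESENTATIONS of the same principal ideal `(f₀) = (f₀′)` of `R`: ring isomorphisms `E₀, E₀′ : S ≃+* K⟦z,u₁,…,uₙ⟧`
with `E₀(f₀) = w · (z^p − ser c₀)`, `E₀′(f₀′) = w′ · (z^p − ser c₀′)`, `w, w′` units. Then `Isol c₀ ↔ Isol c₀′`.
Proof: `f₀′ = a f₀`, `f₀ = b f₀′`; since the atom is non-zero, `f₀ ≠ 0` in `S`, so `1 − ba` is not a unit of the local
ring `R`, i.e. `a` is a unit; with `θ := E₀′ ∘ E₀⁻¹` (a RING automorphism of `K⟦X⟧`, in general not `K`-linear) one gets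
`z^p − ser c₀′ = W · θ(z^p − ser c₀)` with the unit `W = w′⁻¹ · E₀′(a) · θ(w)`, and brick 14 applies.

Consequence (file `…ForcedAtomExists.lean`): in the forced-atom class of the typed Th. 16.6 procedure the clause
«EVERY presentation is isolated» of `terminates_of_le_forcedAtom` (p516034) — kept verbatim in the named regime
`CampaignW46.Regime.forcedAtom` of res-L1-type-o1 (p517839) — follows from «SOME presentation is an isolated `p`-fold
atom» over a perfect field, so the universal clause is redundant and the regime has its natural existential form.
References: bricks 3′, 14 of this seat. [folklore]
-/

noncomputable section

-- single-problem summit: the doubled namespace component `ResolutionOfSingularities` is forced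
set_option linter.dupNamespace false

open scoped BigOperators Classical
open MvPowerSeries IsLocalRing

namespace Summit.ResolutionOfSingularities.ResolutionOfSingularities.Theorems

namespace CampaignW46.AtomGerm

open WildCones

variable {p : ℕ} [Fact p.Prime] {K : Type} [Field K] [CharP K p] [PerfectRing K p] {n : ℕ}

/-- [OURS · L1 W4.6 — DICTIONARY, Isol is independent of the presentation; NOT a statement of the manuscript]
Two formal presentations `E₀(f₀) = w·(z^p − ser c₀)`, `E₀′(f₀′) = w′·(z^p − ser c₀′)` (ring isomorphisms
`E₀, E₀′ : S ≃+* K⟦z,u⟧`, units `w, w′`) of the same principal ideal `(f₀) = (f₀′)` of a local ring `R` over a perfect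
field `K` of characteristic `p` have `Isol c₀ ↔ Isol c₀′`. [folklore] -/
theorem isol_iff_isol_of_span_eq {R S : Type} [CommRing R] [IsLocalRing R] [CommRing S] [Algebra R S]
    (E₀ E₀' : S ≃+* MvPowerSeries (Option (Fin n)) K) (f₀ f₀' : R) (c₀ c₀' : (Fin n → ℕ) → K)
    (w w' : MvPowerSeries (Option (Fin n)) K) (hJ : Ideal.span {f₀} = Ideal.span {f₀'})
    (hw : IsUnit w) (hw' : IsUnit w')
    (hf₀ : E₀ (algebraMap R S f₀) =
      w * ((X none : MvPowerSeries (Option (Fin n)) K) ^ p -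
        rename (some : Fin n → Option (Fin n)) (ser p n K c₀)))
    (hf₀' : E₀' (algebraMap R S f₀') =
      w' * ((X none : MvPowerSeries (Option (Fin n)) K) ^ p -
        rename (some : Fin n → Option (Fin n)) (ser p n K c₀'))) :
    Isol p n K c₀ ↔ Isol p n K c₀' := by
  have hp : p ≠ 0 := (Fact.out : p.Prime).ne_zero
  -- the two generators differ by factors `a`, `b`
  have ha' : f₀' ∈ Ideal.span {f₀} := by
    rw [hJ]
    exact Ideal.mem_span_singleton_self f₀'
  have hb' : f₀ ∈ Ideal.span {f₀'} := by
    rw [← hJ]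
    exact Ideal.mem_span_singleton_self f₀
  obtain ⟨a, ha⟩ := Ideal.mem_span_singleton'.mp ha'
  obtain ⟨b, hb⟩ := Ideal.mem_span_singleton'.mp hb'
  -- the atom is non-zero, hence so is `f₀` in `S`
  have hF : (X none : MvPowerSeries (Option (Fin n)) K) ^ p -
      rename (some : Fin n → Option (Fin n)) (ser p n K c₀) ≠ 0 := fun h =>
    atom_not_mem_maximalIdeal_pow_succ hp (ser p n K c₀) (by rw [h]; exact zero_mem _)
  have hf₀ne : algebraMap R S f₀ ≠ 0 := by
    intro h
    apply hF
    have h1 := hf₀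
    rw [h, map_zero] at h1
    exact (hw.mul_right_eq_zero.mp h1.symm)
  -- `a` is a unit of the local ring `R`
  have haU : IsUnit a := by
    by_contra hna
    have hba : b * a ∈ nonunits R := fun hu => hna (isUnit_of_mul_isUnit_right hu)
    have hu : IsUnit (1 - b * a) := IsLocalRing.isUnit_one_sub_self_of_mem_nonunits (b * a) hba
    have h1 : (1 - b * a) * f₀ = 0 := by
      rw [sub_mul, one_mul, mul_assoc, ha, hb, sub_self]
    exact hf₀ne (by rw [hu.mul_right_eq_zero.mp h1, map_zero])
  -- the ring automorphism `θ = E₀′ ∘ E₀⁻¹` and the unit `W`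
  let θ : MvPowerSeries (Option (Fin n)) K ≃+* MvPowerSeries (Option (Fin n)) K := E₀.symm.trans E₀'
  have hθ : ∀ x : S, θ (E₀ x) = E₀' x := fun x => by
    change E₀' (E₀.symm (E₀ x)) = E₀' x
    rw [RingEquiv.symm_apply_apply]
  obtain ⟨u', hu'⟩ := hw'
  have hW : IsUnit ((↑u'⁻¹ : MvPowerSeries (Option (Fin n)) K) * E₀' (algebraMap R S a) * θ w) :=
    ((Units.isUnit u'⁻¹).mul ((haU.map (algebraMap R S)).map E₀')).mul (hw.map θ)
  have key : (X none : MvPowerSeries (Option (Fin n)) K) ^ p -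
      rename (some : Fin n → Option (Fin n)) (ser p n K c₀') =
        ((↑u'⁻¹ : MvPowerSeries (Option (Fin n)) K) * E₀' (algebraMap R S a) * θ w) *
          θ ((X none : MvPowerSeries (Option (Fin n)) K) ^ p -
            rename (some : Fin n → Option (Fin n)) (ser p n K c₀)) := by
    have h1 : E₀' (algebraMap R S f₀') = E₀' (algebraMap R S a) * (θ w *
        θ ((X none : MvPowerSeries (Option (Fin n)) K) ^ p -
          rename (some : Fin n → Option (Fin n)) (ser p n K c₀))) := by
      rw [← map_mul θ, ← hf₀, hθ, ← map_mul, ← map_mul, ha]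
    rw [hf₀', ← hu'] at h1
    -- cancel the unit `u'`
    have h2 := congrArg (fun x => (↑u'⁻¹ : MvPowerSeries (Option (Fin n)) K) * x) h1
    simp only [← mul_assoc, Units.inv_mul, one_mul] at h2
    rw [h2]
  rw [isol_iff_finite_tjurina' (p := p) c₀, isol_iff_finite_tjurina' (p := p) c₀', key]
  exact (finite_tjurina_iff_of_ringEquiv_option p θ _ _ hW).symm

end CampaignW46.AtomGerm

end Summit.ResolutionOfSingularities.ResolutionOfSingularities.Theorems

end
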